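import Summits.Ventures.HSemireg.AmplificationChainSigmaGluableOfSchemeIso
import Summits.Ventures.HSemireg.DerivedEquivalenceExtRank
import Literature.AlgebraicGeometry.Modules.PushforwardLinear
import HarnessLib

/-!
# Venture HSemireg — ALL `Ext`-ranks of a complex transport along an isomorphism of the base `ℂ`-scheme:
# `extRank Y' (e^* E) n = extRank Y E n`

research route conditional on HC_CM; not a corollary; Q11.4-sentence-2 already refuted in dim ≥ 3.

HONEST FRAMING. Kernel bookkeeping (seat ring2-b06 gen 118; idle-time item agreed by ring2 LEAD 152, ruling L152.5 (R3), HOME INBOX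
2026-08-27 l.4995), sequel to `AmplificationChainSigmaGluableOfSchemeIso.lean` (which proves the rank-`0` case
`extRank Y' (e^*E) n = 0 ↔ extRank Y E n = 0` without linearity). With the `ℂ`-LINEARITY of push-forward along a morphism of
`ℂ`-schemes (`Literature.AlgebraicGeometry.Modules.linear_pushforward`, new) Mathlib makes `D(e⁻¹_*)` a `ℂ`-linear, shift-commuting,
fully faithful functor (`mapDerivedCategory_isEquivalence`), so seat p6's `extRank_eq_of_iso_obj` (`DerivedEquivalenceExtRank.lean`)
applies: **`extRank_pushforward_eq`** — `extRank Y' ((e⁻¹)_* E) n = extRank Y E n` for every `n : ℤ`; and since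
`e^* ≅ (e⁻¹)_*` as functors (`pullbackIsoPushforwardInv`: both are left adjoint to `e_*` — Mathlib `pullbackPushforwardAdjunction` and the
tree's `pushforwardEquivOfIso`), **`extRank_pullback_eq`** — `extRank Y' (e^* E) n = extRank Y E n` (`extRank` is invariant under
isomorphism of complexes: `extRank_congr`). CONSEQUENCE: the `Ext`-side conjuncts of ALL the venture's admissibility notions transport along
`e^*` — `Ext^{<0} = 0` (gluable), `Hom = ℂ` (`sigmaAdmissible`'s `extRank … 0 = 1`), `rank Ext² ≤ r` (`rankAdmissible`):
`extRank_clauses_pullback_iff`. What does NOT follow is unchanged: the σ_q-level statement `HomComplex.IsISemiregularC.of_schemeIso`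
(BANKED by-name support target, L152.5 (R3)).

NOT here: any object, any door word; no skeleton / route change; no `instance`, no axiom, no Literature fact; HC_CM, HC_AV, HC nowhere.

References: [Lieblich2006] Prop. 2.1.9 · [Orlov2002DerivedAbelian] p. 3 (exact equivalences preserve `Extⁱ`) · [Hartshorne1977] II §5 p. 110
(`f^* ⊣ f_*`) · [GortzWedhorn2020] §(7.3), (7.3.6).
-/

noncomputable section

open CategoryTheory CategoryTheory.Limits AlgebraicGeometry
open AlgebraicGeometry.Scheme.Modules
open Literature.AlgebraicGeometry Literature.AlgebraicGeometry.Motives Literature.AlgebraicGeometry.Modules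
open Literature.AlgebraicGeometry.HodgeTheory Literature.AlgebraicGeometry.KTheory

namespace Summit.Ventures.HSemireg

variable {Y Y' : SchemeOver ℂ} (e : Y' ≅ Y)

/-- **`e^* ≅ (e⁻¹)_*`** as functors `Mod 𝒪_Y ⥤ Mod 𝒪_{Y'}` for an isomorphism `e : Y' ≅ Y` of `ℂ`-schemes: both are left adjoint to
`e_*` (Mathlib `pullbackPushforwardAdjunction`; the tree's equivalence `pushforwardEquivOfIso`, reversed), hence isomorphic
(`Adjunction.leftAdjointUniq`). [cite: Hartshorne1977, II §5 p. 110 (f^* ⊣ f_*)] -/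
def pullbackIsoPushforwardInv : Scheme.Modules.pullback e.hom.left ≅ pushforward e.inv.left :=
  Adjunction.leftAdjointUniq (Scheme.Modules.pullbackPushforwardAdjunction e.hom.left)
    (pushforwardEquivOfIso (leftIso' e)).symm.toAdjunction

/-- **`extRank` is invariant under isomorphism of complexes** (on one base). [cite: Lieblich2006, Prop. 2.1.9 (reading: Ext-groups of isomorphic objects)] -/
theorem extRank_congr {E₁ E₂ : CochainComplex Y.left.Modules ℤ} (i : E₁ ≅ E₂) (n : ℤ) :
    extRank Y E₁ n = extRank Y E₂ n := by
  letI := HasDerivedCategory.standard Y.left.Modules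
  exact (extRank_eq_of_iso_obj E₁ E₂ (𝟭 _) (DerivedCategory.Q.mapIso i) n).symm

/-- **All `Ext`-ranks transport along `(e⁻¹)_*`**: `extRank Y' ((e⁻¹)_* E) n = extRank Y E n` — `D((e⁻¹)_*)` is `ℂ`-linear
(`linear_pushforward`), commutes with shifts and is fully faithful (`mapDerivedCategory_isEquivalence`), and
`D((e⁻¹)_*)(Q E) ≅ Q((e⁻¹)_* E)` (Mathlib `mapDerivedCategoryFactors`); seat p6's `extRank_eq_of_iso_obj`.
[cite: Orlov2002DerivedAbelian, p. 3 L33–40 (exact equivalences preserve Ext)] [cite: Lieblich2006, Prop. 2.1.9] -/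
theorem extRank_pushforward_eq (E : CochainComplex Y.left.Modules ℤ) (n : ℤ) :
    extRank Y' (((pushforward e.inv.left).mapHomologicalComplex _).obj E) n = extRank Y E n := by
  letI := HasDerivedCategory.standard Y.left.Modules
  letI := HasDerivedCategory.standard Y'.left.Modules
  haveI : (pushforward e.inv.left).IsEquivalence := isEquivalence_pushforward_left e.symm
  haveI : (pushforward e.inv.left).Linear ℂ := linear_pushforward e.inv
  haveI := Literature.Algebra.Homology.mapDerivedCategory_full (pushforward e.inv.left)
  haveI := Literature.Algebra.Homology.mapDerivedCategory_faithful (pushforward e.inv.left)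
  exact extRank_eq_of_iso_obj E _ (pushforward e.inv.left).mapDerivedCategory
    ((pushforward e.inv.left).mapDerivedCategoryFactors.app E) n

/-- **All `Ext`-ranks transport along `e^*`**: `extRank Y' (e^* E) n = extRank Y E n` for every `n : ℤ` and every isomorphism
`e : Y' ≅ Y` of `ℂ`-schemes (`e^* E ≅ (e⁻¹)_* E` termwise, `extRank_congr`, `extRank_pushforward_eq`).
[cite: Orlov2002DerivedAbelian, p. 3 L33–40] [cite: Lieblich2006, Prop. 2.1.9] -/
theorem extRank_pullback_eq (E : CochainComplex Y.left.Modules ℤ) (n : ℤ) :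
    extRank Y' (((Scheme.Modules.pullback e.hom.left).mapHomologicalComplex _).obj E) n = extRank Y E n := by
  rw [extRank_congr ((NatIso.mapHomologicalComplex (pullbackIsoPushforwardInv e) (ComplexShape.up ℤ)).app E) n]
  exact extRank_pushforward_eq e E n

/-- **The three `Ext`-side admissibility conjuncts transport along `e^*`**: `Ext^{<0} = 0` (gluable), `Hom = ℂ` (rank `1`;
`sigmaAdmissible`), `rank Ext² ≤ r` (`rankAdmissible`) hold for `e^* E` iff they hold for `E`. [cite: Lieblich2006, Prop. 2.1.9]
[cite: Orlov2002DerivedAbelian, p. 3 L33–40] -/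
theorem extRank_clauses_pullback_iff (E : CochainComplex Y.left.Modules ℤ) (r : Cardinal) :
    ((∀ k : ℤ, k < 0 → extRank Y' (((Scheme.Modules.pullback e.hom.left).mapHomologicalComplex _).obj E) k = 0) ∧
        extRank Y' (((Scheme.Modules.pullback e.hom.left).mapHomologicalComplex _).obj E) 0 = 1 ∧
          extRank Y' (((Scheme.Modules.pullback e.hom.left).mapHomologicalComplex _).obj E) 2 ≤ r) ↔
      ((∀ k : ℤ, k < 0 → extRank Y E k = 0) ∧ extRank Y E 0 = 1 ∧ extRank Y E 2 ≤ r) := by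
  simp only [extRank_pullback_eq]

end Summit.Ventures.HSemireg

end
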